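import Mathlib
import HarnessLib
import HarnessLib.Audit
import Summits.QuantumAdvantage.Statement
import Literature.Computability.Cryptography.OneWayFunctions
import Literature.Computability.Cryptography.StatisticalDistance
import Literature.Computability.Cryptography.QuantumQuery
import Literature.Computability.Cryptography.IndistinguishabilityObfuscatorSubexp
import Literature.Computability.Cryptography.PuncturablePRF
import Literature.Computability.Cryptography.ObfuscatedGluedTrees
import Summits.QuantumAdvantage.QuantumAdvantage.Theorems.WhiteBoxWalkSearchToPromiseFree
import HarnessLib.Audit.Status.Attr

/-!
Route: WhiteBoxWalk

X = WbwThesis ("planted unique-answer white-box quantum advantage"; idea card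
whiteboxability-dichotomy).
Words: there are a polynomial-time instance generator gen : {0,1}* -> {0,1}* and an answer function
ans (|ans s| = p(|gen s|)) such that
(Q) ONE poly-time-uniform oracle-free Clifford+T family, given only the instance gen s, outputs ans
s (as a prefix of its measured
wires) with probability >= 2/3 for EVERY seed s, and (C) every probabilistic polynomial-time
algorithm, given (1^n, gen s) for a
uniform seed s in {0,1}^n, outputs ans s with negligible probability (superpolynomial decay in n).
It suffices to show X: X -> not (PromiseBQP <= PromiseBPP') [support WbwSearchToPromise, provable
now: the bitwise promise problems of
a pseudo-deterministic search problem are in PromiseBQP; under PromiseBQP <= PromiseBPP' amplified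
PromiseBPP' deciders recover every
bit of ans s on every instance, contradicting (C) -- the promise form of Aaronson-Gur-Li
arXiv:2602.17647 Thm 1.7] -> [crux
WbwPromiseLift = route PromiseLift's PlLift: BQP <= BPP -> PromiseBQP <= PromiseBPP'] ->
QuantumAdvantage (Assembly, one line).
The card's mechanism is the intended WITNESS of X (crux WbwObfuscatedGluedTrees, rank 2): gen s =
(iO(N_k), name_k(ENTRANCE)), the
obfuscated neighbour circuit of a Childs-et-al. glued-trees graph with pseudorandom authenticated
vertex names, ans s = name_k(EXIT),
classical hardness (C) from sub-exponentially secure iO + puncturable PRFs/injective OWF by a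
punctured-programming hybrid chain in
the Bitansky-Paneth-Rosen template; quantum side (Q) = the continuous-time quantum walk
(ChildsEtAl2003 Thm 3) run on the circuit
(clause (Q) of the typed W; skeleton stub stub_clauseQ). The negative branch of the card's dichotomy
is calibrated by crux WbwVerifiableLineNoSpeedup (rank 3):
the sink-of-verifiable-line structure that the template natively produces has no super-polynomial
quantum query speedup.
DECIDING THEOREM (tribunal repair 2026-08-17, conjunct split; re-glued g5): closes (hH :
WbwCryptoPremise) (hW : WbwObfuscatedGluedTrees)
(hPL : WbwPromiseLift) : QuantumAdvantage — binders = exactly the open cruxes H, W and the residual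
PL; the conditional engine sits IN the
cone: X is DERIVED as have hX : WbwThesis := (W ⟹ WbwEngine) hH; the PROVED support
WbwSearchToPromise (stmt-2240) is DISCHARGED inside the
proof by the landed route-independent theorem
Theorems.WhiteBoxWalk.SearchToPromiseFree.plantedSearch_not_promiseCollapse (p172155;
Theorems/WhiteBoxWalkSearchToPromiseFree.lean, imported by the route file), and the proved Assembly
(stmt-2241) is re-derived in two lines;
ATTACKED crux = W (typed, generator-specific, rank 2); RESIDUAL = WbwPromiseLift (S → PL; PL ≡ S
modulo X; summit-wide shared edge);
CONDITIONAL PREMISE = WbwCryptoPremise (H, held). X itself is the route's TARGET statement.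
Lean (X; elaborates, Sketch.lean rc 0):
∃ (gen ans : List Bool → List Bool), Literature.Computability.Complexity.PolyTimeComputable id id
gen ∧ (∃ p : Polynomial ℕ, ∀ s, (ans s).length = p.eval (gen s).length) ∧ (∃ F :
Literature.Computability.Cryptography.QCircuitFamily
Literature.Computability.Cryptography.cliffordT, F.IsOracleFree ∧ F.IsUniform ∧ ∀ s, 2 / 3 ≤
F.kernelProb 0 (gen s) {y | ans s <+: y}) ∧ ∀ A : Literature.Computability.Complexity.RandAlg (List
Bool) (List Bool), Literature.Computability.Cryptography.IsPPT A id →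
Asymptotics.SuperpolynomialDecay atTop (fun n : ℕ => (n : ℝ)) (fun n : ℕ =>
Literature.Computability.Cryptography.uniformAvg n fun s => A.pr id
(Literature.Computability.Complexity.boolPair (Computability.unaryEncodeNat n) (gen s)) {y | ans s
<+: y})

Rationale: WHY THIS LINE. Aaronson–Chen (AC17 Thm 7.6 / 8.1, arXiv:1612.05903 pp.30-32) show that relative to
suitable oracles sampling-type advantage can be white-boxed when the structure is efficiently
plantable with a unique answer; Bitansky–Paneth–Rosen (BPR15, doi:10.1109/focs.2015.94, Thm 1.1 +
Sec. 5) give the template for turning an oracle separation into a standard-model hardness statement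
by obfuscating the oracle with sub-exponential iO and punctured PRFs. The glued-trees walk (Childs
et al. 2003, arXiv:quant-ph/0209131 Thm 3, Thm 9) is the one exponential quantum-walk speed-up with
a UNIQUE answer (the EXIT name), hence plantable; arXiv:2209.06930 p.9 and arXiv:2602.17647 Thm 1.7
record that its classical hardness survives succinct presentations in the black-box regime. The line
imports cryptography (iO white-boxing) into query complexity: premise H (BPR primitives) and the
typed generator-specific crux W (no 2^{n^ε}-size classical walker finds EXIT of the obfuscated
instance except with sub-exponentially small probability) give the thesis X (an efficiently
plantable unique-answer search problem in FBQP but not in FBPP on average), and X gives the PROMISE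
separation ¬(PromiseBQP ⊆ PromiseBPP') by a proved search-to-promise reduction (WbwSearchToPromise,
stmt-QuantumAdvantage-2240). Structural finding to date: the directed-line version of W is dead
(GrowthClosure negative: affordable plantings have empty growth closure) while the black-box clause
(C) is PROVED from PRF security (blackBoxClauseC_of_prod4PRF), so the live content of W is exactly
the white-box gap for degree-3 neighbour circuits.

CONJUNCT SPLIT AND RESIDUAL (tribunal filing, repair g4 2026-08-17). Write S := QuantumAdvantage = ∃
L ∈ BQP, L ∉ BPP; Q := ¬(PromiseBQP ⊆ PromiseBPP'); PL := WbwPromiseLift = (BQP ⊆ BPP → PromiseBQP ⊆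
PromiseBPP'). In the tree: S → Q (ofLanguage_mem_PromiseBQP_iff / ofLanguage_mem_PromiseBPP'_iff), S
→ PL (trivially), and Q ∧ PL → S is the proved Assembly; PL ≡ (Q → S). Hence S ⟺ Q ∧ PL is a
CONJUNCT SPLIT in the sense of tribunal.md §5 T1′. This route ATTACKS the conjunct Q through the
typed crux WbwObfuscatedGluedTrees (rank 2) under the held conditional premise WbwCryptoPremise (H;
conjecture-grade, never a proof target, not a conjunct of S); it DECLARES RESIDUAL the conjunct
WbwPromiseLift (= PromiseLift.PlLift, shared by 7 routes, home route
route-QuantumAdvantage-PromiseLift, counted once per summit) and does not attack it. NOT A COSTUME: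
relative to the in-tree oracle A = K ⊕ G
(Literature.Barriers.QuantumAdvantage.exists_oracle_P_eq_BQP_infinitePH_promiseBQP_not_subset;
PromiseLiftRelativization.holds) Q^A is TRUE while S^A and PL^A are FALSE, so the attacked
deliverable Q is strictly weaker than S by a separating relativized world and PL carries genuine
non-relativizing content; conversely no registered strong hypothesis or printed theorem gives H → Q
or W (factoring hardness says nothing about obfuscated glued-trees instances), so the attacked
conjunct is not dominated under rule (a). The deciding theorem closes : WbwCryptoPremise →
WbwObfuscatedGluedTrees → WbwPromiseLift → QuantumAdvantage (re-glued g5) has as binders EXACTLY the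
two open cruxes H, W and the residual PL: it derives X internally (X is a target, never a binder: as
a bare hypothesis X is FactoringAssumption-dominated via wbwThesis_of_factoringAssumption) and
DISCHARGES the proved support WbwSearchToPromise inside the proof by the landed route-independent
theorem Theorems.WhiteBoxWalk.SearchToPromiseFree.plantedSearch_not_promiseCollapse (p172155) — a
proved statement left as a binder is read by the kernel tribunal as a strong-hypothesis-dominated
crux (t1c rule (a): FACTNotMemBPP ⇒ WbwSearchToPromise via wbwSearchToPromise_proof), which was the
residual kernel-visible defect of the g4 filing.

RANKED CRUXES. Rank 2 WbwObfuscatedGluedTrees (ATTACKED; typed, generator-specific; proved rungs: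
typedCruxClear_holds p137178 — clause structure under IsSubexpIO; residualAudit_holds p139402 — the
refutation audit modulo H; prfHybridSoundness_holds p163315 and blackBoxClauseC_of_prod4PRF p164036
— the black-box clause (C) from PRF security of the 4-key product, the BC5 witness: a decided
special case of W in a regime where S has no theorem at all). Rank 4 WbwPromiseLift (DECLARED
RESIDUAL, home route PromiseLift; barrier PromiseLiftRelativization catalogued). Rank 5
WbwCryptoPremise (HELD premise H). Target WbwThesis (X, derived). Support WbwEngine (H → X, three
lines from W), WbwSearchToPromise (PROVED), Assembly (PROVED), WbwVerifiableLineNoSpeedup (aside,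
PROVED: the verifiable-line no-speed-up lemma that killed the directed presentation).

KILL CRITERIA. (i) A refutation of W as typed: a 2^{O(n^ε)}-size classical circuit family finding
EXIT of ObfuscatedGluedTrees.gen Λ O P with probability ≥ 2^{-n^ε} for every sub-exponential iO/PRF
instantiation (e.g. a label-leaking feature of the SIV presentation, or a generic "iO of a degree-3
neighbour circuit reveals a pole-to-pole path" attack) closes the route
refuted:WbwObfuscatedGluedTrees. (ii) A proof that every punctured-programming chain on undirected
degree-3 neighbour circuits has empty growth closure for ALL plantings (extending
Negative/GrowthClosure from affordable plantings to all) kills the only known proof technology and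
sends the route dormant pending a new white-boxing mechanism. (iii) A refutation of PL (BQP ⊆ BPP ∧
PromiseBQP ⊄ PromiseBPP' unrelativized) is a refutation of S itself and moots every route.

NOT DECOMPOSED YET. W is attacked whole by its crux chain (Cruxes/WbwObfuscatedGluedTrees:
KnowledgeOfWalkSplit line, PrfHybrid reparametrisation landed). The residual-free variant of this
route — replace PL by the certified canonical lift (Cruxes/PlLift: stub_certify LANDED
PromiseLiftPlLiftStubCertifyK8.lean:183, stub_canonical_lift LANDED
PromiseLiftPlLiftStubCanonicalLiftSiegeK3.lean:158), which needs a CERTIFIED generator-specific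
engine crux — is not typable over the present single-slot SIV generator; it waits on two definition
requests (a pinned-exit multi-slot obfuscated glued-trees generator; an absolutely-sound NIWI proof
layer in Literature/Computability/Cryptography) and is the next tenure move once W's white-box
clause moves. No third layer will be filed. LADDER CEILING (BC9, attacked crux W): method_family =
punctured-programming hybrid chains over sub-exponential iO + puncturable PRFs (BPR15 template) on
an UNDIRECTED degree-3 neighbour circuit; known ceiling strictly short of W = structures with a live
unique producer per name (sink-of-verifiable-line / directed line: BPR15 Thm 1.1,
GargPandeySrinivasan2016; in-tree Negative/GrowthClosure: every AFFORDABLE planting on the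
undirected circuit has EMPTY growth closure, and WbwVerifiableLineNoSpeedup: the directed structure
the template natively yields has no quantum speed-up), i.e. ladder capped at the black-box clause
(C) (blackBoxClauseC_of_prod4PRF, proved) + clear-presentation clause structure
(typedCruxClear_holds); ceiling_lift = a white-box un-naming chain for degree-3 circuits whose
growth closure is non-empty (a new planting beyond point-puncturing, e.g. level-wise decomposable-iO
/ lockable obfuscation of whole BFS levels) — this IS the open content of the declared crux
WbwObfuscatedGluedTrees, so the route is summit-live-conditional-on-H, not a capped frontier ladder.
For the residual PL the ladder is FLAT and capped at its relativizing floors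
(Cruxes/PlLift/LADDER-WbwPromiseLift.md, fwd-ladder-52;
Literature.Barriers.QuantumAdvantage.PromiseLiftRelativization).

CHEAPEST FALSIFIER. Run the generic iO-transparency test on the smallest instance: for n = 8…16,
does the canonical-form (truth-table-level) obfuscation of the degree-3 neighbour circuit of
ObfuscatedGluedTrees.gen admit a polynomial-size classical EXIT-finder that uses only local
consistency of the three producers of each name (the feature that empties the growth closure)? A
positive answer at the perfectly-hiding end of the iO spectrum refutes W for every iO and kills the
route in one computation; a negative answer is the first white-box rung.

Novelty: NOVELTY (searched this session BEFORE claiming: lit read of held/OA texts BitanskyPanethRosen2015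
doi:10.1109/focs.2015.94
pp.3,7,12-17 (Thm 1.1, Def 2.2 SVL, Sec. 5 hybrids Hyb1-Hyb6,j, Claim 5.1, Lemma 5.1 = BCP14),
ChildsEtAl2003 arXiv:quant-ph/0209131
(Thm 3 walk, Thm 9: <= 2^{n/6} classical queries => success <= 4*2^{-n/6}), arXiv:2602.17647 p.5 Thm
1.7, arXiv:2209.06930 p.9,
Ozhigov1999 arXiv:quant-ph/9712051 Thm 1-2, FriedlEtAl2005 arXiv:quant-ph/0505185 p.3; crossref
"indistinguishability obfuscation
quantum advantage", "proof of quantumness indistinguishability obfuscation non-interactive" (0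
relevant; Coladangelo-Gunn
doi:10.1145/3618260.3649779 is about USING quantum iO, not advantage), zbMATH "quantum PPAD" (->
FriedlEtAl2005), crossref pointer
chasing/iterated permutation; searchd, OpenAlex, S2, arXiv APIs unavailable (rc 75 / HTTP 429) --
the card's refuter audit
2026-08-15T04:27Z covered galaxy-intelligent + crossref with the same negative).
Nearest prior art: (1) the white-boxing template for CLASSICAL TFNP: BitanskyPanethRosen2015,
GargPandeySrinivasan2016, GargEtAl2017,
HubacekYogev2020, KomargodskiNaorYogev2019 -- no quantum problem treated; (2) AaronsonChen2017 Thm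
7.6/8.1 (tree
Literature.Barriers.QuantumAdvantage.PPolyOracles): PRF => P/poly-ORACLE separation, i.e. the
chain's first hybrid, stopping at an
oracle; (3) arXiv:2602.17647 (Aaronson-Gur-Li) Thm 1.7: pseudo-deterministic quantum search <=>
P-reducible to a BQP decision
problem -- our glue WbwSe  [refs: 10.1109/focs.2015.94, 10.1145/3618260.3649779, quant-ph/0209131, 2602.17647, 2209.06930, quant-ph/9712051, quant-ph/0505185, doi:10.1109/focs.2015.94, doi:10.1145/3618260.3649779, BitanskyPanethRosen2015, ChildsEtAl2003, Ozhigov1999, FriedlEtAl2005, GargPandeySrinivasan2016, GargEtAl2017, HubacekYogev2020, KomargodskiNaorYogev2019, AaronsonChen2017, SanthaSzegedy2008, BitanskyDegwekarVaikuntanatha]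

Barriers (technique_class: conditional-bridge, obfuscation, punctured-programming, PRF): - technique_class: conditional-bridge, obfuscation, punctured-programming, PRF
- Literature.Barriers.QuantumAdvantage.PPolyOracles (A07, Aaronson–Chen Thm 1.6: SampBPP = SampBQP
and FBPP = FBQP relative to P/poly oracles under OWF): crux WbwObfuscatedGluedTrees sits OUTSIDE its
class — the obstruction is about oracles in P/poly queried as black boxes, whereas W quantifies over
classical circuits that receive the obfuscated CODE; the barrier is exactly why the route needs iO
rather than any efficient oracle, and clause (C) (black-box walkers) is the part the barrier does
not touch and is PROVED (blackBoxClauseC_of_prod4PRF).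
- Literature.Barriers.QuantumAdvantage.SupremacyTheoremsNonRelativizing (A06, AC17 Thm 1.5/8.1):
consistent — the route is explicitly non-relativizing (it uses the code of the obfuscated circuit
and the premise H); the barrier says such a proof MUST be non-relativizing, which this line is by
construction.
- Literature.Barriers.QuantumAdvantage.TotalFunctionSpeedupLimit (A09, Beals et al. /
Aaronson–Ambainis: no super-polynomial quantum speed-up for TOTAL functions in query complexity):
respected and used — the glued-trees EXIT search is a promise/planted problem with a unique answer,
not a total function; the aside WbwVerifiableLineNoSpeedup (PROVED) is this barrier biting the
verifiable directed-line presentation, which is why the crux is stated for the undirected degree-3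
neighbour circuit.
- Literature.Barriers.QuantumAdvantage.PromiseLiftRelativization

Novelty grade: new-combination — Route-review refuter, 3rd pass (typed items pre-CHECKED by earlier seats; my probes rc0 agree; Assembly ⇐ WbwSearchToPromise re-proved). new-combination = BPR15 punctured-programming white-boxing template (A) × ChildsEtAl2003 glued-trees walk + 2^{n/6} classical bound (B), joined for this statement  (refuter refuter-rreview-route-QuantumAdvantage-W-074257fb-0, 2026-08-15T13:58:39Z; prior: doi:10.1109/focs.2015.94 (BitanskyPanethRosen2015 Thm 1.1, Sec. 5: iO+OWF white-boxing of a black-box SVL bound), arXiv:quant-ph/0209131 (ChildsEtAl2003 Thm 3 walk, Thm 9 classical bound), arXiv:1612.05903 (AaronsonChen2017 Thm 7.6 P/poly-oracle separation from OWF; Thm 8.1), arXiv:2209.06930 p.9 (instantiating Simon/glued trees posed as open), arXiv:2602.17647 Thm 1.7 (pseudo-deterministic search)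

History (route lifecycle, newest last):
- 2026-08-16T04:15:24Z · AUTO-CRUX (backfill): WbwThesis — hypotheses of the deciding theorem that nothing in the route derives are cruxes (operator:999:1085951)
- 2026-08-16T06:53:46Z · rev 5: restated WbwEngine (stmt-QuantumAdvantage-14797) — route-choice (planner-rchoice-0ce82196, hold on stmt-QuantumAdvantage-14767 WbwCryptoPremise), step 1/2: RESTATE WbwEngine (stmt-14797) so that the standing cry (planner-rchoice-QuantumAdvantage-WhiteBoxWalk--0ce82196-0)
- 2026-08-16T06:57:03Z · rev 6: dropped WbwCryptoPremise — route-choice (planner-rchoice-0ce82196), step 2/2: DROP the held item WbwCryptoPremise (stmt-QuantumAdvantage-14767). Its body H (∃ ε∈(0,1), SubexpIOExist ε ∧ T (planner-rchoice-QuantumAdvantage-WhiteBoxWalk--0ce82196-0)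
- 2026-08-17T15:58:30Z · rev 8: dropped stmt-QuantumAdvantage-14785, stmt-QuantumAdvantage-2360 — tribunal repair step 1b/2 (retriage landed as rev 7) (summit-strength on WbwPromiseLift): pull the conditional engine into the cone — add the held premise H = W (planner-rbadge-QuantumAdvantage-WhiteBoxWalk-1fca2d14-g3-0)
- 2026-08-17T15:59:04Z · AUTO-CRUX (edit): WbwThesis — hypotheses of the deciding theorem that nothing in the route derives are cruxes (planner-rbadge-QuantumAdvantage-WhiteBoxWalk-1fca2d14-g3-0)

sub-problem: QuantumAdvantage · status: draft · opened planner-plancard-QuantumAdvantage-QuantumAdva-5f1f9d2e-0 2026-08-15T11:02:37Z · rev 12 · ledger route-QuantumAdvantage-WhiteBoxWalk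
GENERATED by the gate from the ledger (D-0016/17). Provers cite these decls: `theorem foo : Summit.QuantumAdvantage.QuantumAdvantage.Theses.WhiteBoxWalk.<Decl> := …` in Summits/QuantumAdvantage/QuantumAdvantage/Theorems/<Name>.lean.
-/

namespace Summit.QuantumAdvantage.QuantumAdvantage.Theses.WhiteBoxWalk

open scoped BigOperators Topology Manifold Classical MeasureTheory ProbabilityTheory Matrix InnerProductSpace ComplexConjugate ContinuousMap
open Filter Set Function TopologicalSpace MeasureTheory

attribute [summit_statement] _root_.QuantumAdvantage

open Literature.QuantumAdvantage

/-- item stmt-QuantumAdvantage-2238 · target (kind.auto-crux: conjecture-grade) · rank 0 · open · by planner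
why it might fail: False iff no efficiently plantable unique-answer advantage exists at all: e.g. BQP ⊆ BPP, or every candidate structure (DLOG/factoring, obfuscated walks) is classically solvable on average; X ⇒ PromiseBQP ⊄ PromiseBPP' ⇒ P ≠ PSPACE-type consequences, so only conditional proofs are expected.
sources: AaronsonChen2017 Thm 7.6, Thm 8.1 (arXiv:1612.05903 pp.30-32), arXiv:2209.06930 p.9, BitanskyPanethRosen2015 Thm 1.1, Sec. 5, Literature.Barriers.QuantumAdvantage.SeparationPrerequisites, Theorems/WhiteBoxWalkWbwThesis.lean (wbwThesis_of_factoringAssumption)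
[target] X = planted unique-answer white-box quantum advantage: a poly-time instance generator gen
and an answer map ans (|ans s| = p(|gen s|)) with (Q) one uniform oracle-free Clifford+T family
outputs ans s (prefix of the measured wires) w.p. >= 2/3 on input gen s for EVERY seed s, and (C)
every PPT given (1^n, gen s), s uniform in {0,1}^n, outputs ans s with negligible probability.
Strictly stronger than PromiseLift's PlThesis (X gives samplable average-case hardness and, via
WbwSearchToPromise, PromiseBQP not<= PromiseBPP'). Intended witness: the obfuscated glued-trees
generator of crux WbwObfuscatedGluedTrees (ans = name of EXIT); also instantiated by
DLOG/factoring-type generators under number-theoretic assumptions (then nothing beyond Shor/AvgCase)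
-- the route's bet is the Shor-neutral iO engine. [card whiteboxability-dichotomy;
BitanskyPanethRosen2015 Sec. 5 (hard SVL DISTRIBUTION as the model of a planted white-box instance);
ChildsEtAl2003; AaronsonChen2017 Thm 7.6/8.1] -/
@[route_item "route-QuantumAdvantage-WhiteBoxWalk"]
def WbwThesis : Prop :=
  ∃ (gen ans : List Bool → List Bool), Literature.Computability.Complexity.PolyTimeComputable id id gen ∧ (∃ p : Polynomial ℕ, ∀ s, (ans s).length = p.eval (gen s).length) ∧ (∃ F : Literature.Computability.Cryptography.QCircuitFamily Literature.Computability.Cryptography.cliffordT, F.IsOracleFree ∧ F.IsUniform ∧ ∀ s, 2 / 3 ≤ F.kernelProb 0 (gen s) {y | ans s <+: y}) ∧ ∀ A : Literature.Computability.Complexity.RandAlg (List Bool) (List Bool), Literature.Computability.Cryptography.IsPPT A id → Asymptotics.SuperpolynomialDecay atTop (fun n : ℕ => (n : ℝ)) (fun n : ℕ => Literature.Computability.Cryptography.uniformAvg n fun s => A.pr id (Literature.Computability.Complexity.boolPair (Computability.unaryEncodeNat n) (gen s)) {y | ans s <+: y})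

/-- item stmt-QuantumAdvantage-2340 · crux · rank 2 · open · by planner
why it might fail: BPR's cheap hybrids kill points whose unique producer is already dead (directed line); in the undirected degree-3 circuit each name has 3 live producers, so affordable plantings have EMPTY growth closure (Negative/GrowthClosure): no chain un-naming EXIT is known; label leakage would break W.
sources: BitanskyPanethRosen2015 Thm 1.1, Def 2.2, Sec. 5 (Hyb1-Hyb6,j, Claim 5.1, Lemma 5.1) pp.3,7,12-17 (doi:10.1109/focs.2015.94), SahaiWaters2014 (punctured programming, doi:10.1145/2591796.2591825), BoyleChungPass2014 (one-point diO from iO), GargPandeySrinivasan2016; GargEtAl2017 (polynomial-loss chains), ChildsEtAl2003 Thm 3, Thm 9 (arXiv:quant-ph/0209131), arXiv:2209.06930 p.9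
[crux] (W)-branch; hypothesis-type until the definitions IsSubexpIO, IsPuncturablePRF
(Literature/Computability/Cryptography) and obfuscatedGluedTreesGen (Summits/.../Theorems) land
(requests filed); signature then: IsSubexpIO-exists -> subexp-injective-OWF-exists -> clause (C) of
WbwThesis for (gen, ans) := obfuscatedGluedTreesGen. OBJECT: for n and lambda = n^c: G'_n = two
complete binary trees of depth n whose leaves are joined by a pseudorandom alternating cycle
determined by a PRF/PRP key k (ChildsEtAl2003 Sec. II); vertex v has name_k(v) = Enc_k(label v) in
{0,1}^{2n+lambda} (deterministic authenticated encryption built from puncturable PRFs, e.g. name =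
(r, F_k(r) xor label, F_k'(r,label)) with r = F_k''(label); invalid strings are rejected); N_k = the
neighbour circuit name -> list of <= 3 neighbour names (bottom on invalid names), padded to size
s(lambda). gen(s): parse s = (k, coins), output boolPair (encoding of iO(N_k) as a list of
single-output circuits via Literature.Computability.QuantumComplexity.encodeCircuit) (name_k
ENTRANCE); ans(s) = name_k(EXIT) zero-padded to length p(|gen s|). CLAIM: if iO is (2^{lambda^eps},
2^{-lambda^eps})-secure for P/poly, F a puncturab -/
@[route_item "route-QuantumAdvantage-WhiteBoxWalk", crux]
def WbwObfuscatedGluedTrees : Prop :=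
  ∀ ε : ℝ, 0 < ε → ε < 1 → Literature.Computability.Cryptography.SubexpIOExist ε → Literature.Computability.Cryptography.TDSecurePuncturablePRFExist (fun κ => (2 : ℝ) ^ ((κ : ℝ) ^ ε)) (fun κ => (2 : ℝ) ^ (-((κ : ℝ) ^ ε))) id id → (∃ f : List Bool → List Bool, Literature.Computability.Cryptography.IsOneWay f ∧ Function.Injective f) → ∃ (Λ : Literature.Computability.Cryptography.ObfuscatedGluedTrees.Params) (O : Literature.Computability.Cryptography.CircuitObfuscator) (P : Literature.Computability.Cryptography.PuncturablePRFScheme), Literature.Computability.Complexity.PolyTimeComputable id id (Literature.Computability.Cryptography.ObfuscatedGluedTrees.gen Λ O P) ∧ (∃ F : Literature.Computability.Cryptography.QCircuitFamily Literature.Computability.Cryptography.cliffordT, F.IsOracleFree ∧ F.IsUniform ∧ ∀ s, 2 / 3 ≤ F.kernelProb 0 (Literature.Computability.Cryptography.ObfuscatedGluedTrees.gen Λ O P s) {y | Literature.Computability.Cryptography.ObfuscatedGluedTrees.ans Λ O P s <+: y}) ∧ ∀ A : Literature.Computability.Complexity.RandAlg (List Bool) (List Bool), Literature.Computability.Cryptography.IsPPT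 A id → Asymptotics.SuperpolynomialDecay atTop (fun n : ℕ => (n : ℝ)) (fun n : ℕ => Literature.Computability.Cryptography.uniformAvg n fun s => A.pr id (Literature.Computability.Complexity.boolPair (Computability.unaryEncodeNat n) (Literature.Computability.Cryptography.ObfuscatedGluedTrees.gen Λ O P s)) {y | Literature.Computability.Cryptography.ObfuscatedGluedTrees.ans Λ O P s <+: y})

/-- item stmt-QuantumAdvantage-0250 · crux · rank 4 · open · by planner
why it might fail: PL fails iff BQP ⊆ BPP while PromiseBQP ⊄ PromiseBPP'; exactly this happens relative to the in-tree oracle K⊕G (PromiseLiftRelativization.holds: BQP^A ⊆ BPP^A, PromiseBQP^A ⊄ PromiseBPP'^A), so no relativizing proof exists; classical analogue prBPP = prP ⇐ BPP = P is open (Goldreich).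
sources: Literature.Barriers.QuantumAdvantage.PromiseLiftRelativization.holds; exists_oracle_P_eq_BQP_infinitePH_promiseBQP_not_subset (Literature/Barriers/QuantumAdvantage/PromiseLiftRelativization.lean), Goldreich2006 On Promise Problems §5.2 (book:editornd-theoretical-computer-science pp.300-303); Goldreich2011 §6, AaronsonArkhipov2013 §10 open problems (9)-(10), Cruxes/PlLift/Disproof.lean (plLift_iff, not_plLift_iff, plLift_of_quantumAdvantage), Cruxes/PlLift/STRATEGY-CENSUS.md, route-QuantumAdvantage-PromiseLift item PlLift (same statement, 7 routes)
OPEN structural question (analogue of 'P = BPP ⇒ prP = prBPP?', Goldreich2011 §1): does equality of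
the language classes force equality of the textbook promise classes? The obstruction: a PromiseBQP
family has no acceptance gap off the promise, so its threshold set is not a BQP language. Most
informative crux of the route: a proof makes every PromiseBQP-completeness result (Jones,
Forrelation) a bona fide reformulation of BQP ≠ BPP; a relativized counterexample would explain why
decision-level quantum advantage evidence is scarce. [Goldreich2006 §1.2; Goldreich2011; Watrous2009
§III.2] -/
@[route_item "route-QuantumAdvantage-WhiteBoxWalk", crux]
def WbwPromiseLift : Prop :=
  Literature.Computability.Cryptography.BQP ⊆ Literature.Computability.Complexity.BPP → Literature.Computability.Cryptography.PromiseBQP ⊆ Literature.Computability.Complexity.PromiseBPP'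

/-- item stmt-QuantumAdvantage-18372 · crux · rank 5 · open · by planner
why it might fail: False iff sub-exponentially secure iO for P/poly, sub-exp-secure puncturable PRFs or injective OWFs do not exist (e.g. NP ⊆ BPP, or every iO candidate incl. Jain–Lin–Sahai's is broken at sub-exponential advantage); standard but unproved assumptions — conjecture-grade, HELD, never a proof target.
sources: JainLinSahai2021 Thm 1.1 (arXiv:2008.09317; doi:10.1145/3406325.3451093), BitanskyPanethRosen2015 §4.2, §5.1 (doi:10.1109/focs.2015.94), SahaiWaters2014 (doi:10.1145/2591796.2591825), Goldreich2001 Def 2.2.1 / §2.2.4.1, Literature.Computability.Cryptography.IndistinguishabilityObfuscatorSubexp (SubexpIOExist), Literature.Computability.Cryptography.PuncturablePRF (TDSecurePuncturablePRFExist)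
[crux] (H) THE STANDING CRYPTOGRAPHIC PREMISE of the route, re-filed as a BINDER of `closes`
(tribunal repair 2026-08-17, planner rbadge g3: the retro tribunal flagged
`conditional-bridge-outside-cone` — the conditional engine must sit IN the cone of the deciding
theorem, so H and the typed engine crux W are now hypotheses of `closes` and X = WbwThesis is
DERIVED inside it). HELD: conjecture-grade, neither constructible nor refutable in the tree (an
injective OWF gives NP ⊄ BPP; ¬H needs unconditional lower bounds) — nobody is seated to prove or
refute it; it is the route's declared conditional premise (role = conditional_on; a route cannot be
converted to --conditional-bridge after open). VERBATIM the antecedent of item WbwEngine and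
`…Cruxes.WbwObfuscatedGluedTrees.KnowledgeOfWalkSplit.Generator.Residual.CryptoPremise`
(`wbwEngine_iff`, Iff.rfl), normalised-equal to the former held item stmt-QuantumAdvantage-14767
(refuter g48-7: survives, held premise). H = the Bitansky–Paneth–Rosen 2015 §5.1 ingredients at one
exponent ε ∈ (0,1): a (2^{κ^ε}, 2^{-κ^ε})-secure indistinguishability obfuscator for P/poly
(SubexpIOExist ε; from sub-exponential SXDH + LWE + LPN + PRG in NC⁰, Jain–Lin -/
@[route_item "route-QuantumAdvantage-WhiteBoxWalk", crux]
def WbwCryptoPremise : Prop :=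
  ∃ ε : ℝ, 0 < ε ∧ ε < 1 ∧ Literature.Computability.Cryptography.SubexpIOExist ε ∧ Literature.Computability.Cryptography.TDSecurePuncturablePRFExist (fun κ => (2 : ℝ) ^ ((κ : ℝ) ^ ε)) (fun κ => (2 : ℝ) ^ (-((κ : ℝ) ^ ε))) id id ∧ ∃ f : List Bool → List Bool, Literature.Computability.Cryptography.IsOneWay f ∧ Function.Injective f

/-- item stmt-QuantumAdvantage-2239 · aside · rank 3 · closed · proved by Summit.QuantumAdvantage.QuantumAdvantage.Theorems.WbwVerifiableLineNoSpeedup.CycleSurgery.WbwVerifiableLineNoSpeedup_of @ b507c013487d (prover) · by planner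
why it might fail: Interleaving V-queries in superposition with S-steps might amplify partially walked prefixes ('verified jumping') beyond min(T,2^{m/2}); Ozhigov's Omega(T) covers S alone and only T <= 2^{m/7}, BBBV covers V alone; no bound for the joint oracle is in print (zbMATH/crossref searched; searchd down).
sources: Ozhigov1999 Thm 1, Thm 2 (arXiv:quant-ph/9712051 p.6), BitanskyPanethRosen2015 Def 2.2 (p.7), FriedlEtAl2005 p.3 (arXiv:quant-ph/0505185), SanthaSzegedy2008, HubacekYogev2020, Literature.Computability.QuantumComplexity.grover_bbbv (QueryComplexity.lean)
[crux] (N)-calibration in the query model; TYPED inline (a definition request svlPromise/svlSinkBit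
asks the librarian to name the inline tables). SINK-OF-VERIFIABLE-LINE as a black-box promise
problem (BitanskyPanethRosen2015 Def 2.2): names {0,1}^m; oracle tables S : {0,1}^m -> {0,1}^m and V
: {0,1}^m x [T] -> {0,1} presented as m*2^m + T*2^m Boolean input bits; promise: there are distinct
x_1 = 0^m, x_2, ..., x_T with S(x_i) = x_{i+1} (i < T) and V(x,i) = 1 <-> x = x_i, S arbitrary off
the line; f = first bit of x_T. CLAIM (= the signature): exists c > 0, forall m >= 2, forall T >= 1
with T+1 <= 2^(m-1): Q_{1/3} on the promise set (input = S-table of 2^m*m bits then V-table of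
2^m*(T+1) bits, line xs : Fin (T+1) -> Fin (2^m) injective with xs 0 = 0, S(xs i) = xs (i+1) bitwise
via Nat.testBit, V(x,i) = [x = xs i]) of f = [the x with V(x, last) = 1 is odd] is >= c * min(T+1,
sqrt(2^m)) / m (the 1/m only weakens the bound: Boolean bit-queries vs name-queries; it still forces
D <= poly(Q, m)). Sanity (K3.lean): the promise set is nonempty (line 0,1,...,T), and m >= 2, T+1 <=
2^(m-1) exclude the degenerate constant cases. Meaning: the structure that every
punctured-programming TFNP h -/
@[route_item "route-QuantumAdvantage-WhiteBoxWalk"]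
def WbwVerifiableLineNoSpeedup : Prop :=
  ∃ c : ℝ, 0 < c ∧ ∀ m T : ℕ, 2 ≤ m → 1 ≤ T → T + 1 ≤ 2 ^ (m - 1) → c * min ((T : ℝ) + 1) (Real.sqrt (2 ^ m)) / m ≤ (Literature.Computability.Cryptography.quantumQueryComplexityOn (1 / 3) {t : Fin (2 ^ m * m + 2 ^ m * (T + 1)) → Bool | ∃ xs : Fin (T + 1) → Fin (2 ^ m), Function.Injective xs ∧ (xs 0).val = 0 ∧ (∀ i : Fin T, ∀ j : Fin m, t (Fin.castAdd (2 ^ m * (T + 1)) (finProdFinEquiv (xs i.castSucc, j))) = (xs i.succ).val.testBit j.val) ∧ ∀ x : Fin (2 ^ m), ∀ i : Fin (T + 1), t (Fin.natAdd (2 ^ m * m) (finProdFinEquiv (x, i))) = decide (x = xs i)} (fun t => decide (∃ x : Fin (2 ^ m), t (Fin.natAdd (2 ^ m * m) (finProdFinEquiv (x, Fin.last T))) = true ∧ x.val % 2 = 1)) : ℝ)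

-- earlier WbwEngine (stmt-QuantumAdvantage-14797, replaced 2026-08-16T06:53:46Z -> stmt-QuantumAdvantage-14957): retired by None — WbwCryptoPremise → WbwThesis
/-- item stmt-QuantumAdvantage-14957 · support · rank 9 · open · by planner
[support] (E) THE ENGINE AS ONE STATEMENT, H ⇒ X, with the standing cryptographic premise H carried
VERBATIM AS ITS ANTECEDENT (route-choice 2026-08-16, planner-rchoice-0ce82196: the former held item
WbwCryptoPremise, stmt-QuantumAdvantage-14767, is dropped — H is conjecture-grade, neither
constructible nor refutable in the tree, so it is never an item to prove, refute, hold or wait on;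
it lives here, where every reader and the cone audit see it). H = the Bitansky–Paneth–Rosen 2015
§5.1 ingredients at one exponent ε ∈ (0,1): a (2^{κ^ε}, 2^{-κ^ε})-secure indistinguishability
obfuscator for P/poly (SubexpIOExist ε; by Jain–Lin–Sahai 2021 Thm 1.1 a consequence of
sub-exponential SXDH + LWE + LPN + PRG in NC⁰), a (2^{κ^ε}, 2^{-κ^ε})-secure length-preserving
puncturable PRF (TDSecurePuncturablePRFExist t δ id id; GGM from sub-exponentially hard OWFs, BPR15
§4.2) and an injective one-way function — exactly the antecedent bundle of CruxShape in
Theorems/WbwObfuscatedGluedTrees/Negative/LoadBearing.lean (not_cruxShape_imp: any ¬ of the typed W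
already proves H). X = item WbwThesis. Statement Iff.rfl-equal to the previous `WbwCryptoPremise →
WbwThesis` (planner Sketch.lean wbwEngineNew_iff' -/
@[route_item "route-QuantumAdvantage-WhiteBoxWalk"]
def WbwEngine : Prop :=
  (∃ ε : ℝ, 0 < ε ∧ ε < 1 ∧ Literature.Computability.Cryptography.SubexpIOExist ε ∧ Literature.Computability.Cryptography.TDSecurePuncturablePRFExist (fun κ => (2 : ℝ) ^ ((κ : ℝ) ^ ε)) (fun κ => (2 : ℝ) ^ (-((κ : ℝ) ^ ε))) id id ∧ ∃ f : List Bool → List Bool, Literature.Computability.Cryptography.IsOneWay f ∧ Function.Injective f) → WbwThesis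

/-- item stmt-QuantumAdvantage-2240 · support · rank 9 · closed · proved by Summit.QuantumAdvantage.QuantumAdvantage.Theorems.WhiteBoxWalk.wbwSearchToPromise_proof (prover) · by planner
[support] Glue, provable now: X -> not (PromiseBQP <= PromiseBPP'). Proof: let (gen, ans, p, F)
witness X. (Q) forces ans s = ans s' whenever gen s = gen s' (two distinct equal-length prefixes
cannot both have probability >= 2/3). Promise problem Pi: inputs boolPair x w with x = gen s for
some s and w in {0,1}^{p(|x|)} one-hot at position i; YES iff bit i of ans s is 1, NO iff it is 0.
Pi in PromiseBQP: a uniform family that runs F's circuit for |x| on x and writes OR_i (w_i AND y_i)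
of the would-be-measured wires y onto wire 0 (Toffoli/Clifford+T, deferred measurement), accepting
w.p. >= 2/3 exactly when the bit is 1. If PromiseBQP <= PromiseBPP', take (L' in P, q) for Pi,
amplify by O(log p) independent repetitions and majority (PromiseBPPAmplification.lean) so each bit
errs w.p. <= 1/(3 p(|x|)); the PPT A that on (1^n, x) queries all p(|x|) positions outputs ans s
w.p. >= 2/3 for EVERY s, so uniformAvg_n >= 2/3 for all n, contradicting superpolynomial decay in
(C). Promise form of Aaronson-Gur-Li arXiv:2602.17647 Thm 1.7 (pd search <=> search-to-decision to
BQP) / Goldwasser-Grossman-Ron 2013. [sources: arXiv:2602.17647 Thm 1.7 p.5; Goldreich2006 Sec. 1.1;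
tree PromiseBPPAmplifi -/
@[route_item "route-QuantumAdvantage-WhiteBoxWalk"]
def WbwSearchToPromise : Prop :=
  (∃ (gen ans : List Bool → List Bool), Literature.Computability.Complexity.PolyTimeComputable id id gen ∧ (∃ p : Polynomial ℕ, ∀ s, (ans s).length = p.eval (gen s).length) ∧ (∃ F : Literature.Computability.Cryptography.QCircuitFamily Literature.Computability.Cryptography.cliffordT, F.IsOracleFree ∧ F.IsUniform ∧ ∀ s, 2 / 3 ≤ F.kernelProb 0 (gen s) {y | ans s <+: y}) ∧ ∀ A : Literature.Computability.Complexity.RandAlg (List Bool) (List Bool), Literature.Computability.Cryptography.IsPPT A id → Asymptotics.SuperpolynomialDecay atTop (fun n : ℕ => (n : ℝ)) (fun n : ℕ => Literature.Computability.Cryptography.uniformAvg n fun s => A.pr id (Literature.Computability.Complexity.boolPair (Computability.unaryEncodeNat n) (gen s)) {y | ans s <+: y})) → ¬ (Literature.Computability.Cryptography.PromiseBQP ⊆ Literature.Computability.Complexity.PromiseBPP')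

/-- item stmt-QuantumAdvantage-2241 · assembly · rank 1 · closed · proved by Summit.QuantumAdvantage.QuantumAdvantage.Theorems.WhiteBoxWalk.assembly_proof @ 3594da211c98 (prover) · by planner
[assembly] X -> PL -> QuantumAdvantage: if the summit fails then BQP <= BPP (every BQP language is
in BPP), PL gives PromiseBQP <= PromiseBPP', contradicting WbwSearchToPromise applied to X. One line
of logic given the glue (checked: Sketch.lean theorem assembly_of_glue). Antecedents inlined: X =
WbwThesis verbatim, PL = WbwPromiseLift = PromiseLift.PlLift verbatim. -/
@[route_item "route-QuantumAdvantage-WhiteBoxWalk"]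
def Assembly : Prop :=
  (∃ (gen ans : List Bool → List Bool), Literature.Computability.Complexity.PolyTimeComputable id id gen ∧ (∃ p : Polynomial ℕ, ∀ s, (ans s).length = p.eval (gen s).length) ∧ (∃ F : Literature.Computability.Cryptography.QCircuitFamily Literature.Computability.Cryptography.cliffordT, F.IsOracleFree ∧ F.IsUniform ∧ ∀ s, 2 / 3 ≤ F.kernelProb 0 (gen s) {y | ans s <+: y}) ∧ ∀ A : Literature.Computability.Complexity.RandAlg (List Bool) (List Bool), Literature.Computability.Cryptography.IsPPT A id → Asymptotics.SuperpolynomialDecay atTop (fun n : ℕ => (n : ℝ)) (fun n : ℕ => Literature.Computability.Cryptography.uniformAvg n fun s => A.pr id (Literature.Computability.Complexity.boolPair (Computability.unaryEncodeNat n) (gen s)) {y | ans s <+: y})) → (Literature.Computability.Cryptography.BQP ⊆ Literature.Computability.Complexity.BPP → Literature.Computability.Cryptography.PromiseBQP ⊆ Literature.Computability.Complexity.PromiseBPP') → QuantumAdvantage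

/-! D-0027 §2.1 — DECIDING THEOREM (planner-authored via `route open/edit --closes-file`; by planner-rbadge-QuantumAdvantage-WhiteBoxWalk-1fca2d14-g5-0 2026-08-17T18:55:57Z):
its hypotheses are this route's items and its conclusion the sub-problem Statement (glue_lint), and it elaborates with this file. -/

@[closes "route-QuantumAdvantage-WhiteBoxWalk"] theorem closes (hH : WbwCryptoPremise) (hW : WbwObfuscatedGluedTrees) (hPL : WbwPromiseLift) : _root_.QuantumAdvantage := by
  classical
  -- the engine item (H → X) follows from the typed generator-specific crux W
  have hE : WbwEngine := by
    rintro ⟨ε, hε, hε1, hIO, hPRF, hf⟩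
    obtain ⟨Λ, O, P, hgen, hQ, hC⟩ := hW ε hε hε1 hIO hPRF hf
    exact ⟨_, _, hgen, Literature.Computability.Cryptography.ObfuscatedGluedTrees.exists_poly_length_ans Λ O P, hQ, hC⟩
  -- the thesis X, derived (not assumed) from the held premise H
  have hX : WbwThesis := hE hH
  -- the PROVED support X → ¬(PromiseBQP ⊆ PromiseBPP') (stmt-QuantumAdvantage-2240), discharged inside the proof by the
  -- landed route-independent theorem (Theorems/WhiteBoxWalkSearchToPromiseFree.lean, p172155), no longer a hypothesis
  have hSP : WbwSearchToPromise :=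
    _root_.Summit.QuantumAdvantage.QuantumAdvantage.Theorems.WhiteBoxWalk.SearchToPromiseFree.plantedSearch_not_promiseCollapse
  -- the Assembly item X → PL → S (stmt-QuantumAdvantage-2241, proved): if S fails then BQP ⊆ BPP, the residual PL collapses
  -- the promise classes, contradicting hSP hX
  have hA : Assembly := by
    intro hX' hPL'
    by_contra hQA
    refine hSP hX' (hPL' ?_)
    intro L hL
    by_contra hn
    exact hQA ⟨L, hL, hn⟩
  exact hA hX hPL

end Summit.QuantumAdvantage.QuantumAdvantage.Theses.WhiteBoxWalk
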